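import Summits.CriticalPhenomena.PercolationContinuityZ3.Theorems.PercNearOneGluingNoHeavyLowerTailSahiTangentAllOrders
import Literature.Combinatorics.Sahi2008.FKG

/-!
# `NoHeavyLowerTail` (crux stmt-CriticalPhenomena-4575), Sahi programme: the minimal-bottom contraction inequality with MINIMAL positivity
# hypotheses, and its ORDER-3 case UNCONDITIONALLY on every FKG lattice

Support file (Sahi cell, seat `prim-sahi-p1`, generation 47; `--supports stmt-CriticalPhenomena-4575`); part 4 of the tangent files.  Pure proofs, NO
definitions, no `sorry`, standard axioms.

`…SahiTangentDisjointSlot` / `…SahiTangentAllOrders` assume the weight Sahi-positive of EVERY order, which is what the chain application supplies.  The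
inductions actually use: Lemma D on `n+2` slots — orders `≤ n+1`; THEOREM A on `n` slots — orders `< n` for `B_p ⊗ μ` (and nothing for `μ`).  This file
re-runs the same proofs with these hypotheses (`…_of_le`, `…_of_lt` versions; proofs verbatim) and draws the order-3 consequence, where orders `≤ 2` = the
FKG inequality: **for EVERY FKG probability weight `μ` on a finite distributive lattice** (e.g. product measure on `{0,1}^E`, i.e. bond percolation),
`p ∈ [0,1]`, increasing `0 ≤ b_l ≤ t_l` (`l < 3`) with a minimal bottom slot `j` (`b_j b_i = b_j t_i`):
  `p · E_3^{μ}(t_0,t_1,t_2) + (1 − p) · E_3^{μ}(t[j ← b_j]) ≤ E_3^{B_p ⊗ μ}(F)`   (`sahiE_three_coin_ge_of_minimal_bottom_fkg`),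
UNCONDITIONALLY (no `C_3` hypothesis; the two `E_3` on the left may have any sign).  Percolation reading (p2's any-edge induction for the increasing star,
memo FROM-prim-sahi-p2-gen32-TANGENT §9(d)): along an edge `g` of weight `p` and targets with `{s↔t_j in G−g} ⊆ {s↔t_i in G−g}` for the other targets
`i`, `E_3(G) ≥ p·E_3(G/g) + (1−p)·E_3^{(E∖g)}({s↔t_i in G/g}_{i≠j}, {s↔t_j in G−g})`.  HONEST LABEL: nothing here asserts `C_3`, Kahn's conjecture,
Conjecture T in general or the increasing star. [this work]
-/

namespace Summit.CriticalPhenomena.PercolationContinuityZ3.Theorems.SahiTangent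

open Finset Function Literature.Combinatorics.Sahi2008
open scoped BigOperators

section DisjointSlot

variable {β : Type*} [Fintype β] [Preorder β]

/-- **A disjoint slot is nonpositive (minimal positivity hypothesis).**  As `sahiE_nonpos_of_prod_eq_zero` of `…SahiTangentDisjointSlot`,
but assuming Sahi positivity of `ρ ≥ 0` only at the orders `≤ n+1` that the induction uses.  Let `ρ ≥ 0` be such a weight,
`f_0 ≥ 0` ANY function and `f_1,…,f_{n+1} ≥ 0` monotone, with `f_0 · f_1 ⋯ f_{n+1} ≡ 0`.  Then `E_{n+2}(f_0,…,f_{n+1}) ≤ 0`.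
(Induction on `n` through the Lieb–Sahi recursion: every term `E_{n+1}(…, f_i f_0, …)` has the same shape one order down,
and the last term is `−E_{n+1}(f_1,…)·E f_0 ≤ 0`; at `n = 0`, `E_2(f_0,f_1) = −E f_0 · E f_1`.) [this work] -/
theorem sahiE_nonpos_of_prod_eq_zero_of_le {ρ : β → ℝ} (hρ₀ : ∀ x, 0 ≤ ρ x) :
    ∀ (n : ℕ), (∀ k, k ≤ n + 1 → SahiPositive ρ k) → ∀ (f : Fin (n + 2) → β → ℝ), (∀ x, 0 ≤ f 0 x) → (∀ i : Fin (n + 1), ∀ x, 0 ≤ f i.succ x) →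
      (∀ i : Fin (n + 1), Monotone (f i.succ)) → (∀ x, ∏ i, f i x = 0) → sahiE ρ (n + 2) f ≤ 0 := by
  intro n
  induction n with
  | zero =>
    intro hpos f h0 hs0 _ hprod
    rw [sahiE_succ_succ]
    have h1 : ∀ i : Fin 1, sahiE ρ 1 (update (Fin.tail f) i (Fin.tail f i * f 0)) = 0 := by
      intro i
      have hi : i = 0 := Subsingleton.elim i 0
      subst hi
      rw [sahiE_one_apply, update_self, ex]
      refine Finset.sum_eq_zero fun x _ => ?_
      have hx := hprod x
      rw [Fin.prod_univ_succ, Fin.prod_univ_one] at hx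
      show ρ x * (f (Fin.succ 0) x * f 0 x) = 0
      rw [mul_comm (f (Fin.succ 0) x), hx, mul_zero]
    have h2 : 0 ≤ sahiE ρ 1 (Fin.tail f) * ex ρ (f 0) := by
      rw [sahiE_one_apply]
      exact mul_nonneg (ex_nonneg hρ₀ (hs0 0)) (ex_nonneg hρ₀ h0)
    rw [Finset.sum_eq_zero fun i _ => h1 i]
    linarith
  | succ m ih =>
    intro hpos f h0 hs0 hsm hprod
    have hpos' : ∀ k, k ≤ m + 1 → SahiPositive ρ k := fun k hk => hpos k (by omega)
    rw [sahiE_succ_succ]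
    have hterm : ∀ i : Fin (m + 2), sahiE ρ (m + 2) (update (Fin.tail f) i (Fin.tail f i * f 0)) ≤ 0 := by
      intro i
      set g : Fin (m + 2) → β → ℝ := update (Fin.tail f) i (Fin.tail f i * f 0) with hg
      let σ : Equiv.Perm (Fin (m + 2)) := Equiv.swap 0 i
      have hσ0 : σ 0 = i := Equiv.swap_apply_left 0 i
      have hσs : ∀ k : Fin (m + 1), σ k.succ ≠ i := by
        intro k hk
        have h' := congrArg σ hk
        rw [Equiv.swap_apply_self, Equiv.swap_apply_right] at h'
        exact Fin.succ_ne_zero k h'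
      rw [← sahiE_comp_perm ρ (m + 2) σ g]
      refine ih hpos' (fun k => g (σ k)) ?_ ?_ ?_ ?_
      · intro x
        show 0 ≤ g (σ 0) x
        rw [hσ0, hg, update_self]
        exact mul_nonneg (hs0 i x) (h0 x)
      · intro k x
        show 0 ≤ g (σ k.succ) x
        rw [hg, update_of_ne (hσs k)]
        exact hs0 _ x
      · intro k
        show Monotone (g (σ k.succ))
        rw [hg, update_of_ne (hσs k)]
        exact hsm _
      · intro x
        have e1 : (∏ k : Fin (m + 2), g (σ k) x) = ∏ l : Fin (m + 2), g l x :=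
          Equiv.prod_comp σ (fun l => g l x)
        rw [e1, Fin.prod_univ_succAbove _ i]
        have e2 : g i x = Fin.tail f i x * f 0 x := by rw [hg, update_self]; rfl
        have e3 : ∀ k : Fin (m + 1), g (i.succAbove k) x = Fin.tail f (i.succAbove k) x := by
          intro k; rw [hg, update_of_ne (Fin.succAbove_ne i k)]
        simp_rw [e2, e3]
        have hx := hprod x
        rw [Fin.prod_univ_succ, Fin.prod_univ_succAbove _ i] at hx
        -- hx : f 0 x * (f i.succ x * ∏ k, f (i.succAbove k).succ x) = 0
        have e4 : ∀ l : Fin (m + 2), Fin.tail f l x = f l.succ x := fun l => rfl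
        simp_rw [e4]
        linear_combination hx
    have hlast : 0 ≤ sahiE ρ (m + 2) (Fin.tail f) * ex ρ (f 0) :=
      mul_nonneg (hpos (m + 2) le_rfl _ hs0 hsm) (ex_nonneg hρ₀ h0)
    have hsum : (∑ i : Fin (m + 2), sahiE ρ (m + 2) (update (Fin.tail f) i (Fin.tail f i * f 0))) ≤ 0 :=
      Finset.sum_nonpos fun i _ => hterm i
    linarith

/-- **Arbitrary slot (minimal positivity hypothesis).**  Same, with the disjoint (not necessarily monotone) function in slot `i` and the other slots monotone
nonnegative. [this work] -/
theorem sahiE_nonpos_of_prod_eq_zero_of_le' {ρ : β → ℝ} (hρ₀ : ∀ x, 0 ≤ ρ x)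
    {n : ℕ} (hpos : ∀ k, k ≤ n + 1 → SahiPositive ρ k) (f : Fin (n + 2) → β → ℝ) (i : Fin (n + 2)) (hi0 : ∀ x, 0 ≤ f i x)
    (h0 : ∀ l, l ≠ i → ∀ x, 0 ≤ f l x) (hm : ∀ l, l ≠ i → Monotone (f l)) (hprod : ∀ x, ∏ l, f l x = 0) :
    sahiE ρ (n + 2) f ≤ 0 := by
  let σ : Equiv.Perm (Fin (n + 2)) := Equiv.swap 0 i
  have hσ0 : σ 0 = i := Equiv.swap_apply_left 0 i
  have hσs : ∀ k : Fin (n + 1), σ k.succ ≠ i := by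
    intro k hk
    have h' := congrArg σ hk
    rw [Equiv.swap_apply_self, Equiv.swap_apply_right] at h'
    exact Fin.succ_ne_zero k h'
  rw [← sahiE_comp_perm ρ (n + 2) σ f]
  refine sahiE_nonpos_of_prod_eq_zero_of_le hρ₀ n hpos (fun k => f (σ k)) ?_ ?_ ?_ ?_
  · intro x; show 0 ≤ f (σ 0) x; rw [hσ0]; exact hi0 x
  · intro k x; exact h0 _ (hσs k) x
  · intro k; exact hm _ (hσs k)
  · intro x
    rw [Equiv.prod_comp σ (fun l => f l x)]
    exact hprod x


end DisjointSlot

section Raise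

variable {α : Type*} [Fintype α] [Preorder α]

/-- **Raising one bottom lowers `E_n` (minimal positivity hypothesis: orders `≤ n+1` on `n+2` slots).**  Pair families `F_l(ε,x) = (ε ? t_l x : b_l x)` on `Bool × α` under a weight `ρ` on `Bool × α`
that is `≥ 0` and Sahi-positive of every order (e.g. `B_p ⊗ μ` on `Bool × chain`).  If slot `j ≠ i` has `b_j·b_i = b_j·t_i` (on the support
of the bottom of slot `j` the pair of slot `i` has no defect), then replacing the bottom `b_i` by the top `t_i` does not increase `E_n`:
the difference is `E_n` of the family with `(1−ε)(t_i − b_i)` in slot `i`, a nonnegative slot disjoint from the product of the others.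
(`b₂` is the raised family, described pointwise.) [this work] -/
theorem sahiE_pair_raise_le_of_le {ρ : Bool × α → ℝ} (hρ₀ : ∀ z, 0 ≤ ρ z) {n : ℕ} (hpos : ∀ k, k ≤ n + 1 → SahiPositive ρ k)
    (b b₂ t : Fin (n + 2) → α → ℝ) (hb0 : ∀ l x, 0 ≤ b l x) (hbt : ∀ l x, b l x ≤ t l x) (hbm : ∀ l, Monotone (b l))
    (htm : ∀ l, Monotone (t l)) {i j : Fin (n + 2)} (hij : i ≠ j) (hmin : ∀ x, b j x * b i x = b j x * t i x)
    (hb₂i : ∀ x, b₂ i x = t i x) (hb₂ : ∀ l, l ≠ i → ∀ x, b₂ l x = b l x) :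
    sahiE ρ (n + 2) (fun l (z : Bool × α) => if z.1 then t l z.2 else b₂ l z.2) ≤
      sahiE ρ (n + 2) (fun l (z : Bool × α) => if z.1 then t l z.2 else b l z.2) := by
  set F : Fin (n + 2) → Bool × α → ℝ := fun l z => if z.1 then t l z.2 else b l z.2 with hF
  set φ : Bool × α → ℝ := fun z => if z.1 then 0 else t i z.2 - b i z.2 with hφ
  have e1 : (fun l (z : Bool × α) => if z.1 then t l z.2 else b₂ l z.2) = update F i (F i + φ) := by
    funext l z
    by_cases hl : l = i
    · subst hl
      rw [update_self, Pi.add_apply, hF, hφ]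
      rcases z with ⟨c, x⟩
      cases c
      · simp [hb₂i]
      · simp
    · rw [update_of_ne hl, hF]
      rcases z with ⟨c, x⟩
      cases c
      · simp [hb₂ l hl]
      · simp
  rw [e1, sahiE_update_add, update_eq_self]
  suffices h : sahiE ρ (n + 2) (update F i φ) ≤ 0 by linarith
  refine sahiE_nonpos_of_prod_eq_zero_of_le' hρ₀ hpos (update F i φ) i ?_ ?_ ?_ ?_
  · intro z
    rw [update_self, hφ]
    rcases z with ⟨c, x⟩
    cases c
    · simpa using hbt i x
    · simp
  · intro l hl z
    rw [update_of_ne hl, hF]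
    rcases z with ⟨c, x⟩
    cases c
    · simpa using hb0 l x
    · simpa using (hb0 l x).trans (hbt l x)
  · intro l hl
    rw [update_of_ne hl, hF]
    exact monotone_pairFun (hbm l) (htm l) (hbt l)
  · intro z
    rw [Fin.prod_univ_succAbove _ i, update_self]
    simp_rw [update_of_ne (Fin.succAbove_ne i _)]
    rcases z with ⟨c, x⟩
    cases c
    · obtain ⟨k₀, hk₀⟩ := Fin.exists_succAbove_eq hij.symm
      rw [Fin.prod_univ_succAbove _ k₀, hk₀, hF, hφ]
      simp only [Bool.false_eq_true, if_false]
      have h' : (t i x - b i x) * b j x = 0 := by linear_combination (-1 : ℝ) * hmin x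
      rw [← mul_assoc, h', zero_mul]
    · rw [hφ]
      simp

/-- **Raising all bottoms outside slot `j` (minimal positivity hypothesis)** (iterate the previous lemma over a finset `S ∌ j` of slots): with a minimal bottom at `j`
(`b_j·b_i = b_j·t_i` for all `i`), the family with bottoms raised to tops on `S` has `E_n` at most that of the original family.
[this work] -/
theorem sahiE_pair_raise_finset_le_of_le {ρ : Bool × α → ℝ} (hρ₀ : ∀ z, 0 ≤ ρ z) {n : ℕ} (hpos : ∀ k, k ≤ n + 1 → SahiPositive ρ k)
    (b t : Fin (n + 2) → α → ℝ) (hb0 : ∀ l x, 0 ≤ b l x) (hbt : ∀ l x, b l x ≤ t l x) (hbm : ∀ l, Monotone (b l))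
    (htm : ∀ l, Monotone (t l)) (j : Fin (n + 2)) (hmin : ∀ i x, b j x * b i x = b j x * t i x) :
    ∀ S : Finset (Fin (n + 2)), j ∉ S →
      sahiE ρ (n + 2) (fun l (z : Bool × α) => if z.1 then t l z.2 else (if l ∈ S then t l else b l) z.2) ≤
        sahiE ρ (n + 2) (fun l (z : Bool × α) => if z.1 then t l z.2 else b l z.2) := by
  intro S
  induction S using Finset.induction_on with
  | empty =>
    intro _
    simp only [Finset.notMem_empty, if_false, le_refl]
  | insert i S hiS ih =>
    intro hj
    rw [Finset.mem_insert, not_or] at hj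
    obtain ⟨hji, hjS⟩ := hj
    -- the family raised on `S`
    set b' : Fin (n + 2) → α → ℝ := fun l => if l ∈ S then t l else b l with hb'
    have hb'0 : ∀ l x, 0 ≤ b' l x := by
      intro l x; rw [hb']; dsimp only; split_ifs
      · exact (hb0 l x).trans (hbt l x)
      · exact hb0 l x
    have hb't : ∀ l x, b' l x ≤ t l x := by
      intro l x; rw [hb']; dsimp only; split_ifs
      · exact le_rfl
      · exact hbt l x
    have hb'm : ∀ l, Monotone (b' l) := by
      intro l; rw [hb']; dsimp only; split_ifs
      · exact htm l
      · exact hbm l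
    have hb'j : b' j = b j := by rw [hb']; dsimp only; rw [if_neg hjS]
    have hb'i : b' i = b i := by rw [hb']; dsimp only; rw [if_neg hiS]
    have hmin' : ∀ x, b' j x * b' i x = b' j x * t i x := by
      intro x; rw [hb'j, hb'i]; exact hmin i x
    have step := sahiE_pair_raise_le_of_le hρ₀ hpos b' (fun l => if l ∈ insert i S then t l else b l) t hb'0 hb't hb'm htm
      (Ne.symm hji) hmin' (fun x => by simp) (fun l hl x => by
        rw [hb']; dsimp only; simp [Finset.mem_insert, hl])
    exact step.trans (ih hjS)

/-- **THEOREM A with the minimal positivity hypothesis** (as `sahiE_coin_ge_of_minimal_bottom` of `…SahiTangentAllOrders`, but the coin product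
`B_p ⊗ μ` is only assumed Sahi-positive at the orders `< n` that the raising steps use — at `n = 3`: Harris on `Bool × α`).  Let `μ ≥ 0` be a weight
on a finite preorder `α` and `p ∈ [0,1]`.  Let `b_l ≤ t_l` (`l < n`) be monotone nonnegative functions on `α` ("bottoms" and "tops", i.e. a general
increasing function `F_l(ε,x) = (ε ? t_l x : b_l x)` on `Bool × α` in every slot) and suppose slot `j` has a MINIMAL bottom:
`b_j · b_i = b_j · t_i` for every `i` (for indicators: `U_j⁰ ⊆ U_i⁰`).  Then
  `p · E_n^{μ}(t) + (1 − p) · E_n^{μ}(t_0,…,b_j,…,t_{n−1}) ≤ E_n^{B_p ⊗ μ}(F)`.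
Proof: raising the bottoms of all slots `≠ j` only lowers `E_n` (`sahiE_pair_raise_finset_le`), and the single-defect family evaluates to the
left-hand side (`sahiE_coin_single_defect`). [this work] -/
theorem sahiE_coin_ge_of_minimal_bottom_of_lt {μ : α → ℝ} (hμ₀ : ∀ x, 0 ≤ μ x) {p : ℝ} (hp₀ : 0 ≤ p) (hp₁ : p ≤ 1)
    {n : ℕ} (hposC : ∀ k, k < n → SahiPositive (fun z : Bool × α => if z.1 then p * μ z.2 else (1 - p) * μ z.2) k)
    (b t : Fin n → α → ℝ) (hb0 : ∀ l x, 0 ≤ b l x) (hbt : ∀ l x, b l x ≤ t l x) (hbm : ∀ l, Monotone (b l))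
    (htm : ∀ l, Monotone (t l)) (j : Fin n) (hmin : ∀ i x, b j x * b i x = b j x * t i x) :
    p * sahiE μ n t + (1 - p) * sahiE μ n (update t j (b j)) ≤
      sahiE (fun z : Bool × α => if z.1 then p * μ z.2 else (1 - p) * μ z.2) n
        (fun l (z : Bool × α) => if z.1 then t l z.2 else b l z.2) := by
  match n, hposC, b, t, j, hb0, hbt, hbm, htm, hmin with
  | 0, _, _, _, j, _, _, _, _, _ => exact j.elim0
  | 1, _, b, t, j, _, _, _, _, _ =>
    have hj : j = 0 := Subsingleton.elim j 0
    subst hj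
    have e : (fun l (z : Bool × α) => if z.1 then t l z.2 else b l z.2) =
        fun l (z : Bool × α) => if z.1 then t l z.2 else update t 0 (b 0) l z.2 := by
      funext l z
      have hl : l = 0 := Subsingleton.elim l 0
      subst hl
      rw [update_self]
    rw [e, sahiE_coin_single_defect]
  | k + 2, hposC, b, t, j, hb0, hbt, hbm, htm, hmin =>
    have hρ₀ := coin_nonneg hμ₀ hp₀ hp₁
    have hraise := sahiE_pair_raise_finset_le_of_le hρ₀ (fun l hl => hposC l (by omega)) b t hb0 hbt hbm htm j hmin
      (Finset.univ.erase j)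
      (Finset.notMem_erase j _)
    have e : (fun l (z : Bool × α) => if z.1 then t l z.2 else (if l ∈ Finset.univ.erase j then t l else b l) z.2) =
        fun l (z : Bool × α) => if z.1 then t l z.2 else update t j (b j) l z.2 := by
      funext l z
      by_cases hl : l = j
      · subst hl
        simp
      · have hmem : l ∈ Finset.univ.erase j := Finset.mem_erase.2 ⟨hl, Finset.mem_univ l⟩
        rw [if_pos hmem, update_of_ne hl]
    rw [e, sahiE_coin_single_defect] at hraise
    exact hraise


end Raise

/-! ### Order 3 on an FKG lattice: unconditional -/

section FKGThree

variable {α : Type*} [Fintype α] [DistribLattice α]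

/-- The coin product `B_p ⊗ μ` of an FKG probability weight on a finite distributive lattice is an FKG probability weight on `Bool × α`
(`p ∈ [0,1]`; the `Bool` factor is log-modular). [this work] -/
theorem isFKGMeasure_coin {μ : α → ℝ} (hμ : IsFKGMeasure μ) {p : ℝ} (hp₀ : 0 ≤ p) (hp₁ : p ≤ 1) :
    IsFKGMeasure (fun z : Bool × α => if z.1 then p * μ z.2 else (1 - p) * μ z.2) where
  nonneg z := coin_nonneg hμ.nonneg hp₀ hp₁ z
  sum_eq_one := by
    have h := hμ.sum_eq_one
    simp only [Fintype.sum_prod_type, Fintype.sum_bool, if_true, Bool.false_eq_true, if_false, ← Finset.mul_sum, h]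
    ring
  mul_le_mul a c := by
    rcases a with ⟨a1, x⟩
    rcases c with ⟨c1, y⟩
    have key := hμ.mul_le_mul x y
    have hx := hμ.nonneg x
    have hy := hμ.nonneg y
    have h1p : 0 ≤ 1 - p := sub_nonneg.2 hp₁
    show (if (a1, x).1 then p * μ (a1, x).2 else (1 - p) * μ (a1, x).2) * (if (c1, y).1 then p * μ (c1, y).2 else (1 - p) * μ (c1, y).2) ≤
      (if ((a1, x) ⊓ (c1, y)).1 then p * μ ((a1, x) ⊓ (c1, y)).2 else (1 - p) * μ ((a1, x) ⊓ (c1, y)).2) *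
        (if ((a1, x) ⊔ (c1, y)).1 then p * μ ((a1, x) ⊔ (c1, y)).2 else (1 - p) * μ ((a1, x) ⊔ (c1, y)).2)
    cases a1 <;> cases c1 <;> simp <;> nlinarith [mul_nonneg hp₀ hp₀, mul_nonneg h1p h1p, mul_nonneg hp₀ h1p, key, hx, hy]

/-- **ORDER 3, EVERY FKG LATTICE, UNCONDITIONAL.**  For an FKG probability weight `μ` on a finite distributive lattice, `p ∈ [0,1]`, monotone
`0 ≤ b_l ≤ t_l` (`l < 3`) and a slot `j` with a minimal bottom (`b_j · b_i = b_j · t_i` for all `i`):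
`p · E_3^{μ}(t) + (1 − p) · E_3^{μ}(t[j ← b_j]) ≤ E_3^{B_p ⊗ μ}(F)`, `F_l(ε,x) = (ε ? t_l x : b_l x)`.  (THEOREM A at `n = 3`: the raising steps only
use Sahi positivity of `B_p ⊗ μ` at orders `≤ 2`, i.e. the FKG inequality on `Bool × α`.) [this work] -/
theorem sahiE_three_coin_ge_of_minimal_bottom_fkg {μ : α → ℝ} (hμ : IsFKGMeasure μ) {p : ℝ} (hp₀ : 0 ≤ p) (hp₁ : p ≤ 1)
    (b t : Fin 3 → α → ℝ) (hb0 : ∀ l x, 0 ≤ b l x) (hbt : ∀ l x, b l x ≤ t l x) (hbm : ∀ l, Monotone (b l))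
    (htm : ∀ l, Monotone (t l)) (j : Fin 3) (hmin : ∀ i x, b j x * b i x = b j x * t i x) :
    p * sahiE μ 3 t + (1 - p) * sahiE μ 3 (update t j (b j)) ≤
      sahiE (fun z : Bool × α => if z.1 then p * μ z.2 else (1 - p) * μ z.2) 3
        (fun l (z : Bool × α) => if z.1 then t l z.2 else b l z.2) :=
  sahiE_coin_ge_of_minimal_bottom_of_lt hμ.nonneg hp₀ hp₁
    (fun k hk => sahiPositive_of_le_two (isFKGMeasure_coin hμ hp₀ hp₁) (by omega)) b t hb0 hbt hbm htm j hmin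

end FKGThree

end Summit.CriticalPhenomena.PercolationContinuityZ3.Theorems.SahiTangent
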